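import Literature.NumberTheory.NumberFields.CubicField14483Witnesses
import Literature.NumberTheory.NumberFields.CubicField14483PrimesTwo
import Literature.NumberTheory.NumberFields.CubicField14483Units
import Literature.NumberTheory.NumberFields.ClassGroupCertDK
import Mathlib.Analysis.Real.Pi.Bounds
import HarnessLib

/-!
# The cubic field of discriminant `-14483`, VII: `d_K = -14483`, Minkowski bound `34`, and `Cl(K) = ⟨[𝔭₂]⟩ ≅ ℤ/8`

Seventh file on the `2`-division field `K = ℚ(γ)`, `γ³ - γ² + 27γ + 36 = 0`, of `E_{28/9}`; assembles the class group
from the prime-ideal witnesses of parts V–VI (`CubicField14483Ideals/Witnesses/PrimesTwo`):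

* §1 `discr_K` — **`d_K = -14483`** (the two power bases `γ`, `δ` have `Δ = 3²·d`, `4²·d'` with index determinants
  dividing `3`, `4`; comparing forces index `3` for `γ`).
* §2 `floor_minkowskiBound_le` — **`⌊M_K⌋ ≤ 34`** (`M_K = (4/π)(3!/3³)√14483 ≈ 34.05`).
* §3 `psi_two_gamma` (`ψ₁(γ) = 0` for every `ψ₁ : 𝓞 K → ℤ/2`) and, for a subgroup `H ∋ [𝔭₂]`, `𝔭₂ = ker ψ₁`:
  `ClassIn H P` for every prime `P` above `2, 3, 5, 7` (witnesses), above `11, 13, 17, 31` (inert), and for the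
  degree-one primes above `19, 23, 29` (witnesses) — `classIn_of_mem_primesOver_le` collects them.
* §4 **`Cl(K) = ⟨[𝔭₂]⟩`** (`classGroup_eq_top_of_classIn_p2`, `mem_zpowers_p2`), **`[𝔭₂]⁸ = 1`** (`(6 + γ - δ) = 𝔭₂⁸`),
  **`[𝔭₂]⁴ ≠ 1`** (`not_isPrincipal_p2_pow_four`: a generator `β` of `𝔭₂⁴` would give `6 + γ - δ = ±ε^{0,1} β'²`,
  refuted by the residue maps at `(19, γ - 15)`, `(29, γ - 19)`, `(5, γ - 3)`), hence **`orderOf [𝔭₂] = 8`**,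
  **`h_K = 8`** (`classNumber_eq`) and **`Cl(K)[2] = {1, [𝔭₂]⁴}`** (`sq_eq_one_iff`).

Everything is proved; theorems only (LMFDB number field 3.1.14483.1: `h = 8`, class group cyclic).

## References
* [Marcus2018] D. A. Marcus, *Number Fields*, 2nd ed. (2018), Ch. 5, Thm. 35–37 and Cor. 2 of Thm. 35; Ch. 3, Thm. 27.
-/

noncomputable section

open Polynomial Module NumberField Ideal InfinitePlace
open scoped NumberField nonZeroDivisors Real

namespace Literature.NumberTheory.NumberFields

/-! ### `ClassIn`: powers and witnesses (generic) -/

/-- `ClassIn H` passes to powers. [cite: Marcus2018, Ch. 5, Thm. 37] -/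
theorem ClassIn.pow {K : Type*} [Field K] [NumberField K] {H : Subgroup (ClassGroup (𝓞 K))} {I : Ideal (𝓞 K)}
    (hI : ClassIn H I) (k : ℕ) : ClassIn H (I ^ k) := by
  induction k with
  | zero => rw [pow_zero, Ideal.one_eq_top]; exact ClassIn.top H
  | succ k ih => rw [pow_succ]; exact ih.mul hI

/-- **A witness `(x) = P · Qᵏ` with `ClassIn H Q` gives `ClassIn H P`** (`[P] = [Q]⁻ᵏ`). [cite: Marcus2018, Ch. 5, Thm. 37] -/
theorem ClassIn.of_span_eq_mul_pow {K : Type*} [Field K] [NumberField K] {H : Subgroup (ClassGroup (𝓞 K))}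
    {P Q : Ideal (𝓞 K)} (hQ : ClassIn H Q) (hQ0 : Q ≠ ⊥) {x : 𝓞 K} {k : ℕ} (h : span {x} = P * Q ^ k) :
    ClassIn H P :=
  ClassIn.of_mul (h ▸ ClassIn.span_singleton H x) (hQ.pow k) (pow_ne_zero k hQ0)

namespace CubicField14483

open MonicCubic

variable {K : Type*} [Field K] [NumberField K] {γ : K}

/-! ### §1 The discriminant -/

/-- **`d_K = -14483`.** From `Δ(f) = 3²·(-14483) = i₁² d_K`, `Δ(g) = 4²·(-14483) = i₂² d_K` (`i₁ ∣ 3` the index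
determinant of `γ`, `i₂` that of `δ`): `16 i₁² = 9 i₂²` forces `3 ∣ i₁`, so `i₁ = ±3`. [cite: Marcus2018, Ch. 2, Exercise 27(c)] -/
theorem discr_K (hγ : γ ^ 3 - γ ^ 2 + 27 * γ + 36 = 0) (h3 : finrank ℚ K = 3) : NumberField.discr K = -14483 := by
  have e1 := discr_powerBasis_eq_indexDet_sq_mul_discr (pb irreducible_polyQ (aeval_eq hγ) h3)
    (isIntegral_pb_gen irreducible_polyQ (aeval_eq hγ) h3)
  have e2 := discr_powerBasis_eq_indexDet_sq_mul_discr (pb irreducible_polyQ_delta (delta_root hγ) h3)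
    (isIntegral_pb_gen irreducible_polyQ_delta (delta_root hγ) h3)
  have hd1 := indexDet_dvd_of_discr_eq_sq_mul (pb irreducible_polyQ (aeval_eq hγ) h3)
    (isIntegral_pb_gen irreducible_polyQ (aeval_eq hγ) h3) 3 (-14483) (by rw [discr_pb, disc_eq]) squarefree_neg_14483
  rw [discr_pb, disc_eq] at e1
  rw [discr_pb, disc_delta_eq] at e2
  set i1 := indexDet (pb irreducible_polyQ (aeval_eq hγ) h3) (isIntegral_pb_gen irreducible_polyQ (aeval_eq hγ) h3)
  set i2 := indexDet (pb irreducible_polyQ_delta (delta_root hγ) h3)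
    (isIntegral_pb_gen irreducible_polyQ_delta (delta_root hγ) h3)
  set d := NumberField.discr K
  have z1 : (3 : ℤ) ^ 2 * (-14483) = i1 ^ 2 * d := by exact_mod_cast e1
  have z2 : (4 : ℤ) ^ 2 * (-14483) = i2 ^ 2 * d := by exact_mod_cast e2
  have key : (4 * i1) ^ 2 = 3 * (3 * i2 ^ 2) := by
    have hd0 : d ≠ 0 := NumberField.discr_ne_zero K
    have h : (16 * i1 ^ 2) * d = (9 * i2 ^ 2) * d := by linear_combination 16 * z1.symm - 9 * z2.symm
    have h' := mul_right_cancel₀ hd0 h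
    linear_combination h'
  have h3i : (3 : ℤ) ∣ i1 := by
    have h : (3 : ℤ) ∣ (4 * i1) ^ 2 := ⟨3 * i2 ^ 2, key⟩
    exact ((Int.prime_three.dvd_mul).mp (Int.prime_three.dvd_of_dvd_pow h)).resolve_left (by norm_num)
  have habs : i1.natAbs = 3 := Nat.dvd_antisymm (Int.natAbs_dvd_natAbs.mpr hd1) (Int.natAbs_dvd_natAbs.mpr h3i)
  have hsq : i1 ^ 2 = 9 := by rw [← Int.natAbs_sq, habs]; norm_num
  rw [hsq] at z1
  linarith

/-! ### §2 The Minkowski bound -/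

/-- **`⌊M_K⌋ ≤ 34`**: `M_K = (4/π) · (3!/3³) · √14483 < (4/3.14) · (6/27) · 120.4 < 35`. [cite: Marcus2018, Ch. 5, Cor. 2 of Thm. 37] -/
theorem floor_minkowskiBound_le (hγ : γ ^ 3 - γ ^ 2 + 27 * γ + 36 = 0) (h3 : finrank ℚ K = 3) :
    ⌊(4 / Real.pi) ^ nrComplexPlaces K *
        ((finrank ℚ K).factorial / (finrank ℚ K : ℝ) ^ finrank ℚ K * Real.sqrt |(NumberField.discr K : ℝ)|)⌋₊ ≤ 34 := by
  rw [h3, discr_K hγ h3, nrComplexPlaces_eq_one hγ h3, pow_one]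
  have hfac : ((3 : ℕ).factorial : ℝ) = 6 := by norm_num [Nat.factorial]
  rw [hfac]
  have hs : Real.sqrt |((-14483 : ℤ) : ℝ)| ≤ 120.4 := by
    rw [show |((-14483 : ℤ) : ℝ)| = 14483 by norm_num, Real.sqrt_le_left (by norm_num)]; norm_num
  have hπ : (3.14 : ℝ) ≤ Real.pi := Real.pi_gt_d2.le
  refine Nat.le_of_lt_succ ((Nat.floor_lt (by positivity)).mpr ?_)
  calc 4 / Real.pi * (6 / (3 : ℝ) ^ 3 * Real.sqrt |((-14483 : ℤ) : ℝ)|)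
      ≤ 4 / 3.14 * (6 / (3 : ℝ) ^ 3 * 120.4) := by gcongr
    _ < ((34 : ℕ).succ : ℝ) := by norm_num

/-! ### §3 The primes of norm `≤ 34` have class in any subgroup containing `[𝔭₂]` -/

/-- **Every `ψ₁ : 𝓞 K → ℤ/2` has `ψ₁(γ) = 0`** (`f ≡ X(X² + X + 1) (mod 2)` has the single root `0`), so `ker ψ₁ = 𝔭₂ = (2, γ)`.
[cite: Marcus2018, Ch. 3, Thm. 27] -/
theorem psi_two_gamma (hγ : γ ^ 3 - γ ^ 2 + 27 * γ + 36 = 0) (ψ₁ : 𝓞 K →+* ZMod 2) :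
    ψ₁ (thetaInt (aeval_eq hγ)) = 0 := by
  have hroot : ∀ x : ZMod 2, x ^ 3 - x ^ 2 + 27 * x + 36 = 0 → x = 0 := by decide
  have h := congrArg ψ₁ (gamma_rel hγ)
  simp only [map_add, map_sub, map_mul, map_pow, map_ofNat, map_zero] at h
  exact hroot _ h

/-- A residue map `𝓞 K → ℤ/2` exists. [cite: Marcus2018, Ch. 3, Thm. 27] -/
theorem exists_psi_two (hγ : γ ^ 3 - γ ^ 2 + 27 * γ + 36 = 0) (h3 : finrank ℚ K = 3) :
    ∃ ψ₁ : 𝓞 K →+* ZMod 2, ψ₁ (thetaInt (aeval_eq hγ)) = 0 := by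
  have r0 : ((0 : ℤ) : ZMod 2) ^ 3 + ((-1 : ℤ) : ZMod 2) * ((0 : ℤ) : ZMod 2) ^ 2 + ((27 : ℤ) : ZMod 2) * (0 : ℤ) +
      ((36 : ℤ) : ZMod 2) = 0 := by decide
  haveI : Fact (Nat.Prime 2) := ⟨Nat.prime_two⟩
  obtain ⟨ψ₁, h, -⟩ := exists_residueHom_gamma hγ h3 (p := 2) (by norm_num) 0 r0
  exact ⟨ψ₁, by rw [h, Int.cast_zero]⟩

/-- `𝔭₂ = ker ψ₁` is a non-zero-divisor. [cite: Marcus2018, Ch. 3, Thm. 27] -/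
theorem ker_psi_two_mem_nonZeroDivisors (ψ₁ : 𝓞 K →+* ZMod 2) : RingHom.ker ψ₁ ∈ (Ideal (𝓞 K))⁰ :=
  haveI : Fact (Nat.Prime 2) := ⟨Nat.prime_two⟩
  mem_nonZeroDivisors_of_ne_zero (ker_zmod_ne_bot ψ₁)

/-- **Primes above `2`**: `𝔭₂ = ker ψ₁` itself, and `𝔮₂` with `(2) = 𝔭₂ 𝔮₂`. [cite: Marcus2018, Ch. 5, Thm. 37] -/
theorem classIn_of_mem_primesOver_two (hγ : γ ^ 3 - γ ^ 2 + 27 * γ + 36 = 0) (h3 : finrank ℚ K = 3)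
    (ψ₁ : 𝓞 K →+* ZMod 2) {H : Subgroup (ClassGroup (𝓞 K))} (hH : ClassIn H (RingHom.ker ψ₁))
    {P : Ideal (𝓞 K)} (hP : P ∈ primesOver (span {((2 : ℕ) : ℤ)}) (𝓞 K)) : ClassIn H P := by
  have c0 : ((0 : ℤ) : ZMod 2) = 0 := by decide
  haveI : Fact (Nat.Prime 2) := ⟨Nat.prime_two⟩
  have h₁ := psi_two_gamma hγ ψ₁
  rcases eq_span_of_mem_primesOver_two hγ h3 hP with h | h
  · rw [h, ← ker_residueHom_eq_span irreducible_polyQ (aeval_eq hγ)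
      (not_dvd_exponent hγ h3 Nat.prime_two (by norm_num)) ψ₁ (by rw [h₁, c0])]
    exact hH
  · rw [h]
    refine ClassIn.of_mul ?_ hH (ker_zmod_ne_bot ψ₁)
    rw [mul_comm, ← span_two_eq hγ h3 ψ₁]
    exact ClassIn.span_singleton H _

/-- **Primes above `3`** (`3 = 𝔭₃ₐ 𝔭₃ᵦ 𝔭₃꜀`, witnesses `(4 - γ) = 𝔭₃ₐ 𝔭₂⁶`, `(-22 + 2γ - 5δ) = 𝔭₃ᵦ 𝔭₂⁷`,
`(2 - 4γ - δ) = 𝔭₃꜀ 𝔭₂⁴`). [cite: Marcus2018, Ch. 5, Thm. 37] -/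
theorem classIn_of_mem_primesOver_three (hγ : γ ^ 3 - γ ^ 2 + 27 * γ + 36 = 0) (h3 : finrank ℚ K = 3)
    (ψ₁ : 𝓞 K →+* ZMod 2) {H : Subgroup (ClassGroup (𝓞 K))} (hH : ClassIn H (RingHom.ker ψ₁))
    {P : Ideal (𝓞 K)} (hP : P ∈ primesOver (span {((3 : ℕ) : ℤ)}) (𝓞 K)) : ClassIn H P := by
  have c0 : ((0 : ℤ) : ZMod 3) = 0 := by decide
  have c1 : ((1 : ℤ) : ZMod 3) = 1 := by decide
  have c2 : ((2 : ℤ) : ZMod 3) = 2 := by decide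
  have e0 : (1 : ZMod 3) - ((0 : ℤ) : ZMod 3) ^ 2 = 1 := by decide
  have e1 : (1 : ZMod 3) - ((1 : ℤ) : ZMod 3) ^ 2 = 0 := by decide
  have e2 : (1 : ZMod 3) - ((2 : ℤ) : ZMod 3) ^ 2 = 0 := by decide
  haveI : Fact (Nat.Prime 2) := ⟨Nat.prime_two⟩
  haveI : Fact (Nat.Prime 3) := ⟨Nat.prime_three⟩
  have h₁ := psi_two_gamma hγ ψ₁
  obtain ⟨φ₀, h0δ, h0γ⟩ := exists_residueHom_three hγ h3 0
  obtain ⟨φ₁, h1δ, h1γ⟩ := exists_residueHom_three hγ h3 1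
  obtain ⟨φ₂, h2δ, h2γ⟩ := exists_residueHom_three hγ h3 2
  obtain ⟨-, hP'⟩ := eq_ker_of_mem_primesOver_three hγ h3 φ₀ φ₁ φ₂ h0δ h1δ h2δ hP
  rw [e0] at h0γ; rw [e1] at h1γ; rw [e2] at h2γ
  rw [c0] at h0δ; rw [c1] at h1δ; rw [c2] at h2δ
  rcases hP' with rfl | rfl | rfl
  · exact ClassIn.of_span_eq_mul_pow hH (ker_zmod_ne_bot ψ₁) (span_witness_p3a hγ h3 ψ₁ h₁ φ₀ h0γ h0δ)
  · exact ClassIn.of_span_eq_mul_pow hH (ker_zmod_ne_bot ψ₁) (span_witness_p3b hγ h3 ψ₁ h₁ φ₁ h1γ h1δ)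
  · exact ClassIn.of_span_eq_mul_pow hH (ker_zmod_ne_bot ψ₁) (span_witness_p3c hγ h3 ψ₁ h₁ φ₂ h2γ h2δ)

/-- **Primes above `5`** (`𝔭₅ = (5, γ - 3)`: `(24 - 2γ + 5δ) = 𝔭₅ 𝔭₂³`; `𝔮₅`: `(-30 - 19γ + δ) = 𝔮₅ 𝔭₂⁵`).
[cite: Marcus2018, Ch. 5, Thm. 37] -/
theorem classIn_of_mem_primesOver_five (hγ : γ ^ 3 - γ ^ 2 + 27 * γ + 36 = 0) (h3 : finrank ℚ K = 3)
    (ψ₁ : 𝓞 K →+* ZMod 2) {H : Subgroup (ClassGroup (𝓞 K))} (hH : ClassIn H (RingHom.ker ψ₁))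
    {P : Ideal (𝓞 K)} (hP : P ∈ primesOver (span {((5 : ℕ) : ℤ)}) (𝓞 K)) : ClassIn H P := by
  have r5 : ((3 : ℤ) : ZMod 5) ^ 3 + ((-1 : ℤ) : ZMod 5) * ((3 : ℤ) : ZMod 5) ^ 2 + ((27 : ℤ) : ZMod 5) * (3 : ℤ) +
      ((36 : ℤ) : ZMod 5) = 0 := by decide
  have d5 : ∀ d : ZMod 5, 3 * d = ((3 : ℤ) : ZMod 5) ^ 2 - ((3 : ℤ) : ZMod 5) + 18 → d = 3 := by decide
  have c3 : ((3 : ℤ) : ZMod 5) = 3 := by decide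
  haveI : Fact (Nat.Prime 2) := ⟨Nat.prime_two⟩
  haveI : Fact (Nat.Prime 5) := ⟨by norm_num⟩
  have h₁ := psi_two_gamma hγ ψ₁
  rcases eq_span_of_mem_primesOver_five hγ h3 hP with h | h
  · obtain ⟨φ, hφγ, hφδ3⟩ := exists_residueHom_gamma hγ h3 (p := 5) (by norm_num) 3 r5
    have hφδ := d5 _ hφδ3
    rw [h, ← ker_residueHom_eq_span irreducible_polyQ (aeval_eq hγ)
      (not_dvd_exponent hγ h3 (p := 5) (by norm_num) (by norm_num)) φ hφγ]
    rw [c3] at hφγ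
    exact ClassIn.of_span_eq_mul_pow hH (ker_zmod_ne_bot ψ₁) (span_witness_p5 hγ h3 ψ₁ h₁ φ hφγ hφδ)
  · rw [h]
    exact ClassIn.of_span_eq_mul_pow hH (ker_zmod_ne_bot ψ₁) (span_witness_q5 hγ h3 ψ₁ h₁)

/-- **Primes above `7`** (`𝔭₇ = (7, γ - 1)`: `(22 + 3γ + 4δ) = 𝔭₇ 𝔭₂⁵`; `𝔮₇ = (7, γ - 6) = (-1 - γ)` principal).
[cite: Marcus2018, Ch. 5, Thm. 37] -/
theorem classIn_of_mem_primesOver_seven (hγ : γ ^ 3 - γ ^ 2 + 27 * γ + 36 = 0) (h3 : finrank ℚ K = 3)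
    (ψ₁ : 𝓞 K →+* ZMod 2) {H : Subgroup (ClassGroup (𝓞 K))} (hH : ClassIn H (RingHom.ker ψ₁))
    {P : Ideal (𝓞 K)} (hP : P ∈ primesOver (span {((7 : ℕ) : ℤ)}) (𝓞 K)) : ClassIn H P := by
  have r1 : ((1 : ℤ) : ZMod 7) ^ 3 + ((-1 : ℤ) : ZMod 7) * ((1 : ℤ) : ZMod 7) ^ 2 + ((27 : ℤ) : ZMod 7) * (1 : ℤ) +
      ((36 : ℤ) : ZMod 7) = 0 := by decide
  have r6 : ((6 : ℤ) : ZMod 7) ^ 3 + ((-1 : ℤ) : ZMod 7) * ((6 : ℤ) : ZMod 7) ^ 2 + ((27 : ℤ) : ZMod 7) * (6 : ℤ) +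
      ((36 : ℤ) : ZMod 7) = 0 := by decide
  have d7 : ∀ d : ZMod 7, 3 * d = ((1 : ℤ) : ZMod 7) ^ 2 - ((1 : ℤ) : ZMod 7) + 18 → d = 6 := by decide
  have c1 : ((1 : ℤ) : ZMod 7) = 1 := by decide
  have c6 : ((6 : ℤ) : ZMod 7) = 6 := by decide
  haveI : Fact (Nat.Prime 2) := ⟨Nat.prime_two⟩
  haveI : Fact (Nat.Prime 7) := ⟨by norm_num⟩
  have h₁ := psi_two_gamma hγ ψ₁
  obtain ⟨φ₁, h1γ, h1δ3⟩ := exists_residueHom_gamma hγ h3 (p := 7) (by norm_num) 1 r1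
  obtain ⟨φ₆, h6γ, -⟩ := exists_residueHom_gamma hγ h3 (p := 7) (by norm_num) 6 r6
  obtain ⟨-, hP'⟩ := eq_ker_of_mem_primesOver_seven hγ h3 φ₁ φ₆ h1γ h6γ hP
  have h1δ := d7 _ h1δ3
  rw [c1] at h1γ; rw [c6] at h6γ
  rcases hP' with rfl | rfl
  · exact ClassIn.of_span_eq_mul_pow hH (ker_zmod_ne_bot ψ₁) (span_witness_p7 hγ h3 ψ₁ h₁ φ₁ h1γ h1δ)
  · rw [← span_witness_q7 hγ h3 φ₆ h6γ]; exact ClassIn.span_singleton H _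

/-- **Inert primes** (`11, 13, 17, 31, …`): every prime above them is `(p)`, principal. [cite: Marcus2018, Ch. 5, Thm. 37] -/
theorem classIn_of_mem_primesOver_inert (hγ : γ ^ 3 - γ ^ 2 + 27 * γ + 36 = 0) (h3 : finrank ℚ K = 3) {p : ℕ}
    (hp : p.Prime) (hp3 : p ≠ 3)
    (hnr : ∀ r : ZMod p, r ^ 3 + ((-1 : ℤ) : ZMod p) * r ^ 2 + ((27 : ℤ) : ZMod p) * r + ((36 : ℤ) : ZMod p) ≠ 0)
    (H : Subgroup (ClassGroup (𝓞 K))) {P : Ideal (𝓞 K)} (hP : P ∈ primesOver (span {(p : ℤ)}) (𝓞 K)) :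
    ClassIn H P :=
  classIn_of_no_root irreducible_polyQ (aeval_eq hγ) hp (not_dvd_exponent hγ h3 hp hp3) hnr H P hP

/-- `f` has no root modulo `13`. [cite: Marcus2018, Ch. 3, Thm. 27] -/
theorem no_root_13 : ∀ r : ZMod 13, r ^ 3 + ((-1 : ℤ) : ZMod 13) * r ^ 2 + ((27 : ℤ) : ZMod 13) * r +
    ((36 : ℤ) : ZMod 13) ≠ 0 := by decide

/-- `f` has no root modulo `17`. [cite: Marcus2018, Ch. 3, Thm. 27] -/
theorem no_root_17 : ∀ r : ZMod 17, r ^ 3 + ((-1 : ℤ) : ZMod 17) * r ^ 2 + ((27 : ℤ) : ZMod 17) * r +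
    ((36 : ℤ) : ZMod 17) ≠ 0 := by decide

/-- `f` has no root modulo `31`. [cite: Marcus2018, Ch. 3, Thm. 27] -/
theorem no_root_31 : ∀ r : ZMod 31, r ^ 3 + ((-1 : ℤ) : ZMod 31) * r ^ 2 + ((27 : ℤ) : ZMod 31) * r +
    ((36 : ℤ) : ZMod 31) ≠ 0 := by decide

/-- **The degree-one prime above `19`** is `(19, γ - 15)`, witness `(-4 - γ) = 𝔭₁₉ 𝔭₂³`. [cite: Marcus2018, Ch. 5, Thm. 37] -/
theorem classIn_of_mem_primesOver_19 (hγ : γ ^ 3 - γ ^ 2 + 27 * γ + 36 = 0) (h3 : finrank ℚ K = 3)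
    (ψ₁ : 𝓞 K →+* ZMod 2) {H : Subgroup (ClassGroup (𝓞 K))} (hH : ClassIn H (RingHom.ker ψ₁))
    {P : Ideal (𝓞 K)} (hP : P ∈ primesOver (span {((19 : ℕ) : ℤ)}) (𝓞 K)) (hle : 19 ^ P.inertiaDeg ℤ ≤ 34) :
    ClassIn H P := by
  have u : ∀ x : ZMod 19, x ^ 3 + ((-1 : ℤ) : ZMod 19) * x ^ 2 + ((27 : ℤ) : ZMod 19) * x + ((36 : ℤ) : ZMod 19) = 0 →
      x = 15 := by decide
  have d : ∀ d : ZMod 19, 3 * d = (15 : ZMod 19) ^ 2 - 15 + 18 → d = 0 := by decide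
  haveI : Fact (Nat.Prime 2) := ⟨Nat.prime_two⟩
  haveI : Fact (Nat.Prime 19) := ⟨by norm_num⟩
  have h₁ := psi_two_gamma hγ ψ₁
  have hexp := not_dvd_exponent hγ h3 (p := 19) (by norm_num) (by norm_num)
  obtain ⟨r, hr, hPeq⟩ := eq_span_pair_of_root' irreducible_polyQ (aeval_eq hγ) (by norm_num) hexp hP hle (by norm_num)
  obtain ⟨φ, hφγ, hφδ3⟩ := exists_residueHom_gamma hγ h3 (p := 19) (by norm_num) r hr
  rw [hPeq, ← ker_residueHom_eq_span irreducible_polyQ (aeval_eq hγ) hexp φ hφγ]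
  have hr' : (r : ZMod 19) = 15 := u _ hr
  rw [hr'] at hφγ hφδ3
  exact ClassIn.of_span_eq_mul_pow hH (ker_zmod_ne_bot ψ₁) (span_witness_p19 hγ h3 ψ₁ h₁ φ hφγ (d _ hφδ3))

/-- **The degree-one prime above `23`** is `(23, γ - 13)`, witness `(60 - 7γ + 16δ) = 𝔭₂₃ 𝔭₂⁶`. [cite: Marcus2018, Ch. 5, Thm. 37] -/
theorem classIn_of_mem_primesOver_23 (hγ : γ ^ 3 - γ ^ 2 + 27 * γ + 36 = 0) (h3 : finrank ℚ K = 3)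
    (ψ₁ : 𝓞 K →+* ZMod 2) {H : Subgroup (ClassGroup (𝓞 K))} (hH : ClassIn H (RingHom.ker ψ₁))
    {P : Ideal (𝓞 K)} (hP : P ∈ primesOver (span {((23 : ℕ) : ℤ)}) (𝓞 K)) (hle : 23 ^ P.inertiaDeg ℤ ≤ 34) :
    ClassIn H P := by
  have u : ∀ x : ZMod 23, x ^ 3 + ((-1 : ℤ) : ZMod 23) * x ^ 2 + ((27 : ℤ) : ZMod 23) * x + ((36 : ℤ) : ZMod 23) = 0 →
      x = 13 := by decide
  have d : ∀ d : ZMod 23, 3 * d = (13 : ZMod 23) ^ 2 - 13 + 18 → d = 12 := by decide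
  haveI : Fact (Nat.Prime 2) := ⟨Nat.prime_two⟩
  haveI : Fact (Nat.Prime 23) := ⟨by norm_num⟩
  have h₁ := psi_two_gamma hγ ψ₁
  have hexp := not_dvd_exponent hγ h3 (p := 23) (by norm_num) (by norm_num)
  obtain ⟨r, hr, hPeq⟩ := eq_span_pair_of_root' irreducible_polyQ (aeval_eq hγ) (by norm_num) hexp hP hle (by norm_num)
  obtain ⟨φ, hφγ, hφδ3⟩ := exists_residueHom_gamma hγ h3 (p := 23) (by norm_num) r hr
  rw [hPeq, ← ker_residueHom_eq_span irreducible_polyQ (aeval_eq hγ) hexp φ hφγ]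
  have hr' : (r : ZMod 23) = 13 := u _ hr
  rw [hr'] at hφγ hφδ3
  exact ClassIn.of_span_eq_mul_pow hH (ker_zmod_ne_bot ψ₁) (span_witness_p23 hγ h3 ψ₁ h₁ φ hφγ (d _ hφδ3))

/-- **The degree-one prime above `29`** is `(29, γ - 19)`, witness `(-18 + 2γ - 5δ) = 𝔭₂₉ 𝔭₂`. [cite: Marcus2018, Ch. 5, Thm. 37] -/
theorem classIn_of_mem_primesOver_29 (hγ : γ ^ 3 - γ ^ 2 + 27 * γ + 36 = 0) (h3 : finrank ℚ K = 3)
    (ψ₁ : 𝓞 K →+* ZMod 2) {H : Subgroup (ClassGroup (𝓞 K))} (hH : ClassIn H (RingHom.ker ψ₁))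
    {P : Ideal (𝓞 K)} (hP : P ∈ primesOver (span {((29 : ℕ) : ℤ)}) (𝓞 K)) (hle : 29 ^ P.inertiaDeg ℤ ≤ 34) :
    ClassIn H P := by
  have u : ∀ x : ZMod 29, x ^ 3 + ((-1 : ℤ) : ZMod 29) * x ^ 2 + ((27 : ℤ) : ZMod 29) * x + ((36 : ℤ) : ZMod 29) = 0 →
      x = 19 := by decide
  have d : ∀ d : ZMod 29, 3 * d = (19 : ZMod 29) ^ 2 - 19 + 18 → d = 4 := by decide
  haveI : Fact (Nat.Prime 2) := ⟨Nat.prime_two⟩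
  haveI : Fact (Nat.Prime 29) := ⟨by norm_num⟩
  have h₁ := psi_two_gamma hγ ψ₁
  have hexp := not_dvd_exponent hγ h3 (p := 29) (by norm_num) (by norm_num)
  obtain ⟨r, hr, hPeq⟩ := eq_span_pair_of_root' irreducible_polyQ (aeval_eq hγ) (by norm_num) hexp hP hle (by norm_num)
  obtain ⟨φ, hφγ, hφδ3⟩ := exists_residueHom_gamma hγ h3 (p := 29) (by norm_num) r hr
  rw [hPeq, ← ker_residueHom_eq_span irreducible_polyQ (aeval_eq hγ) hexp φ hφγ]
  have hr' : (r : ZMod 29) = 19 := u _ hr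
  rw [hr'] at hφγ hφδ3
  exact ClassIn.of_span_eq_mul_pow hH (ker_zmod_ne_bot ψ₁) (span_witness_p29 hγ h3 ψ₁ h₁ φ hφγ (d _ hφδ3))

/-- The primes `≤ 34`. [folklore] -/
private theorem eq_of_prime_le_34 {p : ℕ} (hp : p.Prime) (h : p ≤ 34) :
    p = 2 ∨ p = 3 ∨ p = 5 ∨ p = 7 ∨ p = 11 ∨ p = 13 ∨ p = 17 ∨ p = 19 ∨ p = 23 ∨ p = 29 ∨ p = 31 := by
  interval_cases p
  all_goals (revert hp; decide)

/-- **Every prime `P` above `p ≤ 34` with `p^{f_P} ≤ 34` has `ClassIn H P`** for any `H ∋ [𝔭₂]`. [cite: Marcus2018, Ch. 5, Thm. 37] -/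
theorem classIn_of_mem_primesOver_le (hγ : γ ^ 3 - γ ^ 2 + 27 * γ + 36 = 0) (h3 : finrank ℚ K = 3)
    (ψ₁ : 𝓞 K →+* ZMod 2) {H : Subgroup (ClassGroup (𝓞 K))} (hH : ClassIn H (RingHom.ker ψ₁))
    {p : ℕ} (hp : p.Prime) (hp34 : p ≤ 34) {P : Ideal (𝓞 K)} (hP : P ∈ primesOver (span {(p : ℤ)}) (𝓞 K))
    (hle : p ^ P.inertiaDeg ℤ ≤ 34) : ClassIn H P := by
  rcases eq_of_prime_le_34 hp hp34 with rfl | rfl | rfl | rfl | rfl | rfl | rfl | rfl | rfl | rfl | rfl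
  · exact classIn_of_mem_primesOver_two hγ h3 ψ₁ hH hP
  · exact classIn_of_mem_primesOver_three hγ h3 ψ₁ hH hP
  · exact classIn_of_mem_primesOver_five hγ h3 ψ₁ hH hP
  · exact classIn_of_mem_primesOver_seven hγ h3 ψ₁ hH hP
  · exact classIn_of_mem_primesOver_inert hγ h3 hp (by norm_num) no_root_eleven H hP
  · exact classIn_of_mem_primesOver_inert hγ h3 hp (by norm_num) no_root_13 H hP
  · exact classIn_of_mem_primesOver_inert hγ h3 hp (by norm_num) no_root_17 H hP
  · exact classIn_of_mem_primesOver_19 hγ h3 ψ₁ hH hP hle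
  · exact classIn_of_mem_primesOver_23 hγ h3 ψ₁ hH hP hle
  · exact classIn_of_mem_primesOver_29 hγ h3 ψ₁ hH hP hle
  · exact classIn_of_mem_primesOver_inert hγ h3 hp (by norm_num) no_root_31 H hP

/-! ### §4 `Cl(K) = ⟨[𝔭₂]⟩ ≅ ℤ/8` -/

/-- **A subgroup of `Cl(K)` containing `[𝔭₂]` is everything** (Minkowski bound `34` and §3). [cite: Marcus2018, Ch. 5, Thm. 37] -/
theorem classGroup_eq_top_of_classIn_p2 (hγ : γ ^ 3 - γ ^ 2 + 27 * γ + 36 = 0) (h3 : finrank ℚ K = 3)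
    (ψ₁ : 𝓞 K →+* ZMod 2) {H : Subgroup (ClassGroup (𝓞 K))} (hH : ClassIn H (RingHom.ker ψ₁)) : H = ⊤ :=
  classGroup_eq_top_of_classIn fun _ hp hpr _ hP hle =>
    classIn_of_mem_primesOver_le hγ h3 ψ₁ hH hpr ((Finset.mem_Icc.mp hp).2.trans (floor_minkowskiBound_le hγ h3)) hP
      (hle.trans (floor_minkowskiBound_le hγ h3))

/-- **`Cl(K) = ⟨[𝔭₂]⟩`.** [cite: Marcus2018, Ch. 5, Thm. 37] -/
theorem zpowers_p2_eq_top (hγ : γ ^ 3 - γ ^ 2 + 27 * γ + 36 = 0) (h3 : finrank ℚ K = 3) (ψ₁ : 𝓞 K →+* ZMod 2) :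
    Subgroup.zpowers (ClassGroup.mk0 ⟨RingHom.ker ψ₁, ker_psi_two_mem_nonZeroDivisors ψ₁⟩) = ⊤ :=
  classGroup_eq_top_of_classIn_p2 hγ h3 ψ₁ fun _ => Subgroup.mem_zpowers _

/-- **`[𝔭₂]⁸ = 1`** (`𝔭₂⁸ = (6 + γ - δ)`). [cite: Marcus2018, Ch. 5, Thm. 35] -/
theorem mk0_p2_pow_eight (hγ : γ ^ 3 - γ ^ 2 + 27 * γ + 36 = 0) (h3 : finrank ℚ K = 3) (ψ₁ : 𝓞 K →+* ZMod 2) :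
    ClassGroup.mk0 ⟨RingHom.ker ψ₁, ker_psi_two_mem_nonZeroDivisors ψ₁⟩ ^ 8 = 1 := by
  rw [← map_pow, ClassGroup.mk0_eq_one_iff, SubmonoidClass.coe_pow]
  show (RingHom.ker ψ₁ ^ 8).IsPrincipal
  rw [← span_pi0_eq_p2_pow_eight hγ h3 ψ₁ (psi_two_gamma hγ ψ₁)]
  exact ⟨⟨_, rfl⟩⟩

/-- **`𝔭₂⁴` is not principal.** A generator `β` would give `(6 + γ - δ) = (β²)`, so `6 + γ - δ = u β²` with a unit
`u = ±ε^{0,1} η²`; but `6 + γ - δ ↦ 2` is a non-square mod `(19, γ - 15)`, `-(6 + γ - δ) ↦ 8` a non-square mod `(29, γ - 19)`,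
and `±ε⁻¹(6 + γ - δ) ↦ 2, 3` are non-squares mod `(5, γ - 3)`. [cite: Marcus2018, Ch. 5, Thm. 35] -/
theorem not_isPrincipal_p2_pow_four (hγ : γ ^ 3 - γ ^ 2 + 27 * γ + 36 = 0) (h3 : finrank ℚ K = 3)
    (ψ₁ : 𝓞 K →+* ZMod 2) : ¬ (RingHom.ker ψ₁ ^ 4).IsPrincipal := by
  have r29 : ((19 : ℤ) : ZMod 29) ^ 3 + ((-1 : ℤ) : ZMod 29) * ((19 : ℤ) : ZMod 29) ^ 2 + ((27 : ℤ) : ZMod 29) * (19 : ℤ) +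
      ((36 : ℤ) : ZMod 29) = 0 := by decide
  have d29 : ∀ d : ZMod 29, 3 * d = ((19 : ℤ) : ZMod 29) ^ 2 - ((19 : ℤ) : ZMod 29) + 18 → d = 4 := by decide
  have c19 : ((19 : ℤ) : ZMod 29) = 19 := by decide
  have k29 : ∀ a b : ZMod 29, ((6 : ℤ) : ZMod 29) + ((1 : ℤ) : ZMod 29) * 19 + ((-1 : ℤ) : ZMod 29) * 4 =
      a ^ 2 * ((-1) ^ 1 * (-15 - 19 + 2 * 4) ^ 0 * b ^ 2) → False := by decide
  haveI : Fact (Nat.Prime 29) := ⟨by norm_num⟩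
  obtain ⟨⟨ψ₅, h5γ, h5δ⟩, ⟨ψ₁₉, h19γ, h19δ⟩⟩ := exists_signatureHoms hγ h3
  obtain ⟨ψ₂₉, h29γ, h29δ3⟩ := exists_residueHom_gamma hγ h3 (p := 29) (by norm_num) 19 r29
  have h29δ := d29 _ h29δ3
  rw [c19] at h29γ
  intro hprin
  haveI := hprin
  set g := Submodule.IsPrincipal.generator (RingHom.ker ψ₁ ^ 4) with hg'
  have hg : Ideal.span {g} = RingHom.ker ψ₁ ^ 4 := Ideal.span_singleton_generator _
  have h8 : Ideal.span {((6 : ℤ) : 𝓞 K) + (1 : ℤ) * thetaInt (aeval_eq hγ) + (-1 : ℤ) * thetaInt (delta_root hγ)} =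
      Ideal.span {g ^ 2} := by
    rw [span_pi0_eq_p2_pow_eight hγ h3 ψ₁ (psi_two_gamma hγ ψ₁), show (8 : ℕ) = 4 * 2 from rfl, pow_mul, ← hg,
      Ideal.span_singleton_pow]
  obtain ⟨u, hu⟩ := Ideal.span_singleton_eq_span_singleton.mp h8
  obtain ⟨s, i, η, hη⟩ := unit_eq_rep_mul_sq hγ h3 u⁻¹
  have hfin : ((6 : ℤ) : 𝓞 K) + (1 : ℤ) * thetaInt (aeval_eq hγ) + (-1 : ℤ) * thetaInt (delta_root hγ) =
      g ^ 2 * ((-1) ^ (s : ℕ) * (-15 - thetaInt (aeval_eq hγ) + 2 * thetaInt (delta_root hγ)) ^ (i : ℕ) *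
        (η : 𝓞 K) ^ 2) := by
    have e : ((6 : ℤ) : 𝓞 K) + (1 : ℤ) * thetaInt (aeval_eq hγ) + (-1 : ℤ) * thetaInt (delta_root hγ) =
        g ^ 2 * ((u⁻¹ : (𝓞 K)ˣ) : 𝓞 K) := by
      rw [← hu, mul_assoc, Units.mul_inv, mul_one]
    rw [e, hη]
    push_cast [Units.val_mkOfMulEqOne]
    ring
  have hs : (s : ℕ) = 0 ∨ (s : ℕ) = 1 := by have := s.2; omega
  have hi : (i : ℕ) = 0 ∨ (i : ℕ) = 1 := by have := i.2; omega
  rcases hs with hs | hs <;> rcases hi with hi | hi <;> rw [hs, hi] at hfin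
  · -- `6 + γ - δ = (gη)²`: impossible modulo `(19, γ - 15)`
    have e := congrArg ψ₁₉ hfin
    simp only [map_add, map_sub, map_mul, map_pow, map_neg, map_one, map_intCast, map_ofNat, h19γ, h19δ] at e
    generalize ψ₁₉ g = a at e
    generalize ψ₁₉ (η : 𝓞 K) = b at e
    revert a b
    decide
  · -- `6 + γ - δ = ε (gη)²`: impossible modulo `(5, γ - 3)`
    have e := congrArg ψ₅ hfin
    simp only [map_add, map_sub, map_mul, map_pow, map_neg, map_one, map_intCast, map_ofNat, h5γ, h5δ] at e
    generalize ψ₅ g = a at e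
    generalize ψ₅ (η : 𝓞 K) = b at e
    revert a b
    decide
  · -- `6 + γ - δ = -(gη)²`: impossible modulo `(29, γ - 19)`
    have e := congrArg ψ₂₉ hfin
    simp only [map_add, map_sub, map_mul, map_pow, map_neg, map_one, map_intCast, map_ofNat, h29γ, h29δ] at e
    exact k29 _ _ e
  · -- `6 + γ - δ = -ε (gη)²`: impossible modulo `(5, γ - 3)`
    have e := congrArg ψ₅ hfin
    simp only [map_add, map_sub, map_mul, map_pow, map_neg, map_one, map_intCast, map_ofNat, h5γ, h5δ] at e
    generalize ψ₅ g = a at e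
    generalize ψ₅ (η : 𝓞 K) = b at e
    revert a b
    decide

/-- **`[𝔭₂]⁴ ≠ 1`.** [cite: Marcus2018, Ch. 5, Thm. 35] -/
theorem mk0_p2_pow_four_ne_one (hγ : γ ^ 3 - γ ^ 2 + 27 * γ + 36 = 0) (h3 : finrank ℚ K = 3)
    (ψ₁ : 𝓞 K →+* ZMod 2) : ClassGroup.mk0 ⟨RingHom.ker ψ₁, ker_psi_two_mem_nonZeroDivisors ψ₁⟩ ^ 4 ≠ 1 := by
  rw [← map_pow, Ne, ClassGroup.mk0_eq_one_iff, SubmonoidClass.coe_pow]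
  exact not_isPrincipal_p2_pow_four hγ h3 ψ₁

/-- **`[𝔭₂]` has order `8`.** [cite: Marcus2018, Ch. 5, Thm. 35] -/
theorem orderOf_mk0_p2 (hγ : γ ^ 3 - γ ^ 2 + 27 * γ + 36 = 0) (h3 : finrank ℚ K = 3) (ψ₁ : 𝓞 K →+* ZMod 2) :
    orderOf (ClassGroup.mk0 ⟨RingHom.ker ψ₁, ker_psi_two_mem_nonZeroDivisors ψ₁⟩) = 8 := by
  haveI : Fact (Nat.Prime 2) := ⟨Nat.prime_two⟩
  have h := orderOf_eq_prime_pow (p := 2) (n := 2) (x := ClassGroup.mk0 ⟨RingHom.ker ψ₁, ker_psi_two_mem_nonZeroDivisors ψ₁⟩)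
    (by simpa using mk0_p2_pow_four_ne_one hγ h3 ψ₁) (by simpa using mk0_p2_pow_eight hγ h3 ψ₁)
  simpa using h

/-- **`h_K = 8`.** [cite: Marcus2018, Ch. 5, Thm. 35] -/
theorem classNumber_eq (hγ : γ ^ 3 - γ ^ 2 + 27 * γ + 36 = 0) (h3 : finrank ℚ K = 3) : classNumber K = 8 := by
  obtain ⟨ψ₁, -⟩ := exists_psi_two hγ h3
  rw [classNumber, ← Nat.card_eq_fintype_card, ← orderOf_eq_card_of_forall_mem_zpowers
    (g := ClassGroup.mk0 ⟨RingHom.ker ψ₁, ker_psi_two_mem_nonZeroDivisors ψ₁⟩)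
    (fun x => by rw [zpowers_p2_eq_top hγ h3 ψ₁]; exact Subgroup.mem_top x), orderOf_mk0_p2 hγ h3 ψ₁]

/-- **`Cl(K)[2] = {1, [𝔭₂]⁴}`**: the classes of order dividing `2`. [cite: Marcus2018, Ch. 5, Thm. 35] -/
theorem sq_eq_one_iff (hγ : γ ^ 3 - γ ^ 2 + 27 * γ + 36 = 0) (h3 : finrank ℚ K = 3) (ψ₁ : 𝓞 K →+* ZMod 2)
    (c : ClassGroup (𝓞 K)) :
    c ^ 2 = 1 ↔ c = 1 ∨ c = ClassGroup.mk0 ⟨RingHom.ker ψ₁, ker_psi_two_mem_nonZeroDivisors ψ₁⟩ ^ 4 := by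
  set g := ClassGroup.mk0 ⟨RingHom.ker ψ₁, ker_psi_two_mem_nonZeroDivisors ψ₁⟩ with hg
  have hg8 := mk0_p2_pow_eight hγ h3 ψ₁
  rw [← hg] at hg8
  constructor
  · intro h
    obtain ⟨k, rfl⟩ := Subgroup.mem_zpowers_iff.mp
      (show c ∈ Subgroup.zpowers g by rw [hg, zpowers_p2_eq_top hγ h3 ψ₁]; exact Subgroup.mem_top c)
    have h' : g ^ (k * 2) = 1 := by rw [zpow_mul, zpow_two, ← pow_two]; exact h
    have hdvd := orderOf_dvd_iff_zpow_eq_one.mpr h'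
    rw [hg, orderOf_mk0_p2 hγ h3 ψ₁] at hdvd
    have h4 : (4 : ℤ) ∣ k := by push_cast at hdvd; omega
    obtain ⟨m, rfl⟩ := h4
    rcases Int.even_or_odd m with ⟨j, rfl⟩ | ⟨j, rfl⟩
    · left
      rw [show (4 : ℤ) * (j + j) = 8 * j by ring, zpow_mul, zpow_ofNat, hg8, one_zpow]
    · right
      rw [show (4 : ℤ) * (2 * j + 1) = 8 * j + 4 by ring, zpow_add, zpow_mul, zpow_ofNat, hg8, one_zpow, one_mul,
        zpow_ofNat]
  · rintro (rfl | rfl)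
    · exact one_pow 2
    · rw [← pow_mul]; exact hg8

end CubicField14483

end Literature.NumberTheory.NumberFields

end
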